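import Mathlib
import Summits.ResolutionOfSingularities.ResolutionOfSingularities.Theorems.RadicialJungCleanModelsLens5TFramePDegreeB
import HarnessLib

/-!
# Route `RadicialJung`, crux `CleanModels` (stmt-15917): T⁗ port part 13/13 — `Lens5_PDegreeCount.lean` §F `p`-basis extraction, §G residual lifts, §H THEOREM T⁗‴ `cleanLU3DefectPRankTwoPDeg_of_pMon` (source :637–848; the def is in the currency)

PORT (line lead `res-B-lead-1` g8, for Sketch rev 32) of res-B-lens-5's crux workfiles `Cruxes/DescentPerfectToAll/Lens5_TFrame.lean` rev 4
(crux ae884a356928; author res-B-lens-5 g15; `lean check` rc 0 · 0 sorries · 0 warnings; crit-1 TRIAGE-146/150 PASS) and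
`Cruxes/DescentPerfectToAll/Lens5_PDegreeCount.lean` rev 3 (crux 100289d6413b; TRIAGE-151 PASS): THEOREMS T⁗ / T⁗′ / T⁗″ / T⁗‴ — the slice
{`[Γ:pΓ] = p²`, `k` of FINITE `p`-rank `r`, `[κ_v : κ_v^p] = p^r`} of the research stub `stub_cleanLU3DefectNonDiscrete` (valuations of MINIMAL
Frobenius defect `d(K|K^p, v) = p`, ANY such ground field: no perfectness, no separability of `K/k` or `κ_v/k`), modulo F-02 `CossartPiltant2019` and
F-32 (`hEmb`) only.  The port is split into def-free modules `…Lens5TFrame{RG,IR,Graded,Port2,Port4Core,Layer,Layer2,Port4,Composition,PMon,PDegreeA,PDegreeB,PDegreeC}`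
over ONE currency module `…Lens5TFrameCurrency` (the authors' `def`s, verbatim); declarations VERBATIM, namespace
`Summit.ResolutionOfSingularities.ResolutionOfSingularities.Theorems.RadicialJungCleanModels.Lens5TFrame` (the authors' §A copy of
`Lens5_PDegreeSep` and the constant-frame corollaries `cleanLU3DefectPRankTwoSepFin_of_frame` / `…SepFin_of_cossartPiltant2019'` are not ported).
OURS · counted 0 · nothing here proves resolution in characteristic `p`.


-/

set_option linter.dupNamespace false -- mandated namespace of this single-conjunct summit

noncomputable section

section

open IsLocalRing IntermediateField Module MvPolynomial
open Literature.AlgebraicGeometry.Resolution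
open Summit.ResolutionOfSingularities.ResolutionOfSingularities.Theorems.RadicialJung.CleanModels
open Summit.ResolutionOfSingularities.ResolutionOfSingularities.Theorems.RadicialJung.CleanModels.Lens5
open Summit.ResolutionOfSingularities.ResolutionOfSingularities.Theorems.RadicialJung.CleanModels.Lens5.PRankTwoCurrency
open Summit.ResolutionOfSingularities.ResolutionOfSingularities.Theorems.RadicialJung.CleanModels.Lens5.PRankTwoAssembly
open Summit.ResolutionOfSingularities.ResolutionOfSingularities.Theorems.RadicialJungCleanModels.Lens5RegularityCriterion
open Summit.ResolutionOfSingularities.ResolutionOfSingularities.Theorems.RadicialJungCleanModels.Lens5ChartSurjection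

namespace Summit.ResolutionOfSingularities.ResolutionOfSingularities.Theorems.RadicialJungCleanModels.Lens5TFrame

/-! ## §F From the `p`-degree to a `p`-basis: `[E : E^p] = p^r` gives an injective `p`-independent `β : Fin r → E` with `E = E^p(β)` -/

section PBasis

variable {E : Type} [Field E] (p : ℕ) [Fact p.Prime] [CharP E p]

/-- **A field of `p`-degree `p^r` has a `p`-basis with `r` elements.** [cite: Matsumura1987, §26 p. 202] -/
theorem exists_pBasis_of_finrank {r : ℕ} (h : finrank (frobenius E p).fieldRange E = p ^ r) :
    ∃ β : Fin r → E, Function.Injective β ∧ IsPIndependent (F := (frobenius E p).fieldRange) p (Set.range β) ∧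
      adjoin (frobenius E p).fieldRange (Set.range β) = ⊤ := by
  classical
  have hp : p.Prime := Fact.out
  set Ep : Subfield E := (frobenius E p).fieldRange
  haveI : FiniteDimensional Ep E := Module.finite_of_finrank_pos (by rw [h]; exact pow_pos hp.pos _)
  have hexp : ∀ x : E, x ^ p ∈ (algebraMap Ep E).range := fun x => ⟨⟨x ^ p, x, rfl⟩, rfl⟩
  obtain ⟨Γ, hΓ, htop⟩ := exists_isPIndependent_adjoin_eq_top Ep p hexp
  -- `Γ` is finite: a `p`-independent finite subset `t` has `[E^p(t) : E^p] = p^{#t} ≤ p^r`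
  have hbound : ∀ t : Finset E, (t : Set E) ⊆ Γ → t.card ≤ r := by
    intro t ht
    have h1 : finrank Ep (adjoin Ep (t : Set E)) ≤ finrank Ep E := by
      haveI : FiniteDimensional Ep (⊤ : IntermediateField Ep E) :=
        (IntermediateField.topEquiv (F := Ep) (E := E)).symm.toLinearEquiv.finiteDimensional
      have := IntermediateField.finrank_le_of_le_right (F := adjoin Ep (t : Set E)) (E := (⊤ : IntermediateField Ep E)) le_top
      rwa [finrank_top'] at this
    rw [hΓ t ht, h] at h1
    exact (Nat.pow_le_pow_iff_right hp.one_lt).mp h1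
  have hfin : Γ.Finite := by
    by_contra hinf
    obtain ⟨t, ht, hcard⟩ := Set.Infinite.exists_subset_card_eq hinf (r + 1)
    have := hbound t ht
    omega
  obtain ⟨t₀, rfl⟩ := hfin.exists_finset_coe
  have hcard : t₀.card = r := by
    have h1 := hΓ t₀ subset_rfl
    rw [htop, finrank_top', h] at h1
    exact (Nat.pow_right_injective hp.two_le h1).symm
  have hct : Fintype.card t₀ = r := by rw [Fintype.card_coe, hcard]
  let ε : t₀ ≃ Fin r := Fintype.equivFinOfCardEq hct
  refine ⟨fun i => (ε.symm i : E), ?_, ?_, ?_⟩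
  · intro i j hij
    exact ε.symm.injective (Subtype.ext hij)
  · have hr : Set.range (fun i => (ε.symm i : E)) = (t₀ : Set E) := by
      ext y; constructor
      · rintro ⟨i, rfl⟩; exact (ε.symm i).2
      · intro hy; exact ⟨ε ⟨y, hy⟩, by simp⟩
    rw [hr]; exact hΓ
  · have hr : Set.range (fun i => (ε.symm i : E)) = (t₀ : Set E) := by
      ext y; constructor
      · rintro ⟨i, rfl⟩; exact (ε.symm i).2
      · intro hy; exact ⟨ε ⟨y, hy⟩, by simp⟩
    rw [hr]; exact htop

/-- The subfield generated by the `p`-th powers and a set `S` is `E^p(S)`. [folklore] -/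
theorem closure_powers_union_eq (S : Set E) :
    Subfield.closure (Set.range (fun x : E => x ^ p) ∪ S) = (adjoin (frobenius E p).fieldRange S).toSubfield := by
  rw [adjoin_toSubfield]
  congr 2
  ext y; constructor
  · rintro ⟨x, rfl⟩; exact ⟨⟨x ^ p, x, rfl⟩, rfl⟩
  · rintro ⟨⟨_, x, rfl⟩, rfl⟩; exact ⟨x, rfl⟩

/-- **`k`-side data from the `p`-degree**: `[k : k^p] = p^r` yields `β : Fin r → k` whose `p`-monomials `p`-span `k` and which is `p`-free.
[cite: Matsumura1987, §26 p. 202] -/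
theorem exists_pSpanning_pFree_of_finrank {r : ℕ} (h : finrank (frobenius E p).fieldRange E = p ^ r) :
    ∃ β : Fin r → E, IsPSpanningFamily p (pMonomial p β) ∧
      ∀ i, β i ∉ Subfield.closure (Set.range (fun x : E => x ^ p) ∪ β '' ({i}ᶜ : Set (Fin r))) := by
  classical
  have hp : p.Prime := Fact.out
  set Ep : Subfield E := (frobenius E p).fieldRange
  obtain ⟨β, hβinj, hPI, htop⟩ := exists_pBasis_of_finrank p h
  refine ⟨β, ?_, ?_⟩
  · intro c
    have hc : c ∈ adjoin Ep (Set.range β) := by rw [htop]; exact mem_top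
    have hspan := mem_span_pMonomial_of_mem_adjoin p β hc
    obtain ⟨a, ha⟩ := Submodule.mem_span_range_iff_exists_fun Ep |>.mp hspan
    choose d hd using fun e => RingHom.mem_fieldRange.mp (a e).2
    refine ⟨d, ?_⟩
    rw [← ha]
    refine Finset.sum_congr rfl fun e _ => ?_
    rw [Subfield.smul_def, smul_eq_mul, ← hd e, frobenius_def]
  · intro i hi
    rw [closure_powers_union_eq p] at hi
    change β i ∈ adjoin Ep (β '' ({i}ᶜ : Set (Fin r))) at hi
    -- `E^p(β i) ∩ E^p(β '' {i}ᶜ) = E^p` by `p`-independence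
    have hs : (({β i} : Finset E) : Set E) ⊆ Set.range β := by simp
    have ht : ((Finset.univ.image β).erase (β i) : Set E) = β '' ({i}ᶜ : Set (Fin r)) := by
      ext y
      simp only [Finset.coe_erase, Finset.coe_image, Finset.coe_univ, Set.image_univ, Set.mem_sdiff, Set.mem_range,
        Set.mem_singleton_iff, Set.mem_image, Set.mem_compl_iff]
      constructor
      · rintro ⟨⟨j, rfl⟩, hne⟩; exact ⟨j, fun hji => hne (by rw [hji]), rfl⟩
      · rintro ⟨j, hji, rfl⟩; exact ⟨⟨j, rfl⟩, fun heq => hji (hβinj heq)⟩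
    have ht' : (((Finset.univ.image β).erase (β i) : Finset E) : Set E) ⊆ Set.range β := by
      rw [ht]; rintro _ ⟨j, _, rfl⟩; exact ⟨j, rfl⟩
    have hdisj : Disjoint ({β i} : Finset E) ((Finset.univ.image β).erase (β i)) := by
      rw [Finset.disjoint_singleton_left]; exact Finset.notMem_erase _ _
    have hbot := adjoin_inf_adjoin_eq_bot_of_isPIndependent hPI {β i} ((Finset.univ.image β).erase (β i)) hs ht' hdisj
    have hmem : β i ∈ adjoin Ep (({β i} : Finset E) : Set E) ⊓ adjoin Ep (((Finset.univ.image β).erase (β i) : Finset E) : Set E) := by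
      refine ⟨subset_adjoin Ep _ (by simp), ?_⟩
      rw [ht]; exact hi
    rw [hbot] at hmem
    -- so `E^p(β i) = E^p`, of degree `1 ≠ p`
    have h1 : finrank Ep (adjoin Ep (({β i} : Finset E) : Set E)) = p ^ 1 := by
      rw [hPI {β i} hs, Finset.card_singleton]
    have h2 : adjoin Ep (({β i} : Finset E) : Set E) = ⊥ := by
      rw [Finset.coe_singleton]; exact adjoin_simple_eq_bot_iff.mpr hmem
    rw [h2, IntermediateField.finrank_bot, pow_one] at h1
    exact hp.one_lt.ne h1

/-- The subfield generated by the `p`-th powers is the range of Frobenius. [folklore] -/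
theorem closure_range_pow_eq_fieldRange :
    Subfield.closure (Set.range (fun x : E => x ^ p)) = (frobenius E p).fieldRange := by
  apply le_antisymm
  · refine Subfield.closure_le.mpr ?_
    rintro z ⟨u, rfl⟩
    exact RingHom.mem_fieldRange.mpr ⟨u, frobenius_def ..⟩
  · intro z hz
    obtain ⟨u, rfl⟩ := RingHom.mem_fieldRange.mp hz
    exact Subfield.subset_closure ⟨u, (frobenius_def ..).symm⟩

end PBasis

/-! ## §G The residual side: `[κ_v : κ_v^p] = p^r` gives `r` elements of `O_v` with residually `p`-independent `p`-monomials -/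

section Residual

variable {K : Type} [Field K] (p : ℕ) [Fact p.Prime] (O : ValuationSubring K) [CharP (ResidueField O) p]

/-- **`κ`-side data from the residual `p`-degree**: lifts `w_i ∈ O_v` of a `p`-basis of `κ_v` over `κ_v^p` have residually
`p`-independent `p`-monomials (the residue of `Σ_e w'_e^p W_e` is `Σ_e w̄'_e^p · β̄^e`, and the `β̄^e` are `κ_v^p`-linearly independent).
[cite: Matsumura1987, §26 p. 202] -/
theorem exists_residuallyPIndependent_of_finrank {r : ℕ}
    (h : finrank (frobenius (ResidueField O) p).fieldRange (ResidueField O) = p ^ r) :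
    ∃ w : Fin r → K, (∀ i, w i ∈ O) ∧ ResiduallyPIndependentFamily p O (pMonomial p w) := by
  classical
  have hp : p.Prime := Fact.out
  obtain ⟨βbar, hinj, hPI, -⟩ := exists_pBasis_of_finrank p h
  have hli := linearIndependent_pMonomial p βbar hinj hPI
  choose w₀ hw₀ using fun i => residue_surjective (βbar i)
  refine ⟨fun i => (w₀ i : K), fun i => (w₀ i).2, ?_⟩
  intro w' hw' he
  obtain ⟨e₀, he₀⟩ := he
  set ω : (Fin r → Fin p) → O := fun e => ⟨w' e, hw' e⟩
  set sO : O := ∑ e, ω e ^ p * ∏ i, w₀ i ^ ((e i : Fin p) : ℕ)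
  have hcoe : (sO : K) = ∑ e, w' e ^ p * pMonomial p (fun i => (w₀ i : K)) e := by
    simp [sO, ω, pMonomial]
  rw [← hcoe]
  refine (O.valuation_eq_one_iff sO).mp ?_
  by_contra hnu
  have hres : residue O sO = 0 := (residue_eq_zero_iff _).mpr ((IsLocalRing.mem_maximalIdeal _).mpr hnu)
  have hsum : residue O sO = ∑ e, (residue O (ω e)) ^ p * pMonomial p βbar e := by
    simp only [sO, map_sum, map_mul, map_pow, map_prod, pMonomial, hw₀]
  -- a linear relation among the `p`-monomials of `β̄` with coefficients in `κ^p`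
  let c : (Fin r → Fin p) → (frobenius (ResidueField O) p).fieldRange :=
    fun e => ⟨residue O (ω e) ^ p, residue O (ω e), rfl⟩
  have hrel : ∑ e, c e • pMonomial p βbar e = 0 := by
    rw [← hres, hsum]
    refine Finset.sum_congr rfl fun e _ => ?_
    rw [Subfield.smul_def, smul_eq_mul]
  have hc := (Fintype.linearIndependent_iff.mp hli) c hrel e₀
  have hc' : residue O (ω e₀) ^ p = 0 := by
    have := congrArg Subtype.val hc
    simpa only [c, ZeroMemClass.coe_zero] using this
  have hω : residue O (ω e₀) = 0 := pow_eq_zero_iff hp.ne_zero |>.mp hc'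
  have hunit : IsUnit (ω e₀) := (O.valuation_eq_one_iff (ω e₀)).mpr he₀
  exact ((residue_ne_zero_iff_isUnit _).mpr hunit) hω

end Residual

/-! ## §H THE CANONICAL SLICE (THEOREM T⁗‴): (P2) ∧ `[k : k^p] = p^r` ∧ `[κ_v : κ_v^p] = p^r` — the two `p`-degrees, no frame data -/


/-- **T⁗‴ ⊂ T⁗″** (kernel): the `p`-degrees produce the data — a `p`-basis `β` of `k` (`p`-monomials `p`-span, `β` `p`-free; §F) and lifts
`w_i ∈ O_v` of a `p`-basis of `κ_v` with residually `p`-independent `p`-monomials (§G). [folklore] -/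
theorem cleanLU3DefectPRankTwoPDeg_of_pBasis (p : ℕ) [Fact p.Prime] (hPB : CleanLU3DefectPRankTwoPBasisAt p) :
    CleanLU3DefectPRankTwoPDegAt p := by
  intro k _ _ K _ _ O A hAO hAfg hFrac hdimA hreg hdim3 hzd g₀ hg₀ hdefect htd hnd hP2 r hk hκ
  classical
  have hkO : ∀ c : k, algebraMap k K c ∈ O := fun c => hAO (A.algebraMap_mem c)
  let f : k →+* IsLocalRing.ResidueField O := (IsLocalRing.residue O).comp ((algebraMap k K).codRestrict O hkO)
  haveI : CharP (IsLocalRing.ResidueField O) p := (f.charP_iff_charP p).mp inferInstance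
  rw [closure_range_pow_eq_fieldRange (E := k) p] at hk
  rw [closure_range_pow_eq_fieldRange (E := IsLocalRing.ResidueField O) p] at hκ
  obtain ⟨β, hβspan, hβfree⟩ := exists_pSpanning_pFree_of_finrank p hk
  obtain ⟨w, hwO, hRPI⟩ := exists_residuallyPIndependent_of_finrank p O hκ
  exact hPB k K O A hAO hAfg hFrac hdimA hreg hdim3 hzd g₀ hg₀ hdefect htd hnd hP2 r β hβspan hβfree w hwO hRPI

/-- **T⁗‴ ⊂ T⁗′** (kernel, composing with §D): from T⁗′'s `p`-monomial-frame slice. At port time this composes further with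
`cleanLU3DefectPRankTwoPMon_of_cossartPiltant2019` (`Lens5_TFrame.lean` §I) to give the canonical slice modulo F-02/F-32 only. [folklore] -/
theorem cleanLU3DefectPRankTwoPDeg_of_pMon (p : ℕ) [Fact p.Prime] (hPMon : CleanLU3DefectPRankTwoPMonAt p) :
    CleanLU3DefectPRankTwoPDegAt p :=
  cleanLU3DefectPRankTwoPDeg_of_pBasis p (cleanLU3DefectPRankTwoPBasis_of_pMon p hPMon)

end Summit.ResolutionOfSingularities.ResolutionOfSingularities.Theorems.RadicialJungCleanModels.Lens5TFrame

end
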